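import Literature.NumberTheory.EllipticCurves.RingClassFieldGenusProofs
import Mathlib.FieldTheory.Galois.Infinite
import HarnessLib

/-!
# Radicals outside the ring class fields: `ᵏ√d ∉ K[m]` when `ℓᵃ ∥ d`, `k ∤ a`, `ℓ ∤ m·d_K`
# (Cox §9.A: `K[m]/K` is unramified outside `m`), and scalar Galois descent along `K[m] ↪ K̄`

Topic `NumberTheory/EllipticCurves` (class field theory of the ring class fields
`K[m] = ringClassField K ι m ⊂ ℂ` of `HeegnerPointsOfConductor.lean`), namespace
`Literature.NumberTheory.EllipticCurves`. THEOREMS ONLY (no definition, no named fact, no instance, no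
notation; D-0014/D-0026). Cell `bsd-cm`, row `bsd-cm-k-ty1` ((M1)(K-ty) arithmetic wrapper for VARIANT K
on crux 19804 `UpperOffV0HSYPlus`), fourth seating; `--supports stmt-BirchSwinnertonDyer-19804`. The
Hu–Shu–Yin instance (`∛6 ∉ H_{9pn}`, no `2`-torsion of `E_9, E_p, E_{3p²}` over the tower, the rows'
hypothesis `h6`) is the sequel `HuShuYin2019/SylvesterTowerTwoTorsion.lean`.

WHAT IS PROVED (everything sorry-free, from the tree's PROVED class field theory of `K[m]`):

* §1 (valuations) `dvd_log_valuation_pow`, `pow_ne_of_not_dvd_log_valuation` — a `k`-th power has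
  `w`-adic order divisible by `k` (`ord_w(r^k) = k·ord_w(r)`); `valuation_intCast_of_ramificationIdx_eq_one`
  — at a place `w ∋ ℓ` of a number field `L` with `e(w | ℓ) = 1`, `ord_w(ℓᵃ·d') = a` for `ℓ ∤ d'`
  (Mathlib `intValuation_liesOver`); `pow_ne_intCast_of_ramificationIdx_eq_one` — hence `ℓᵃ d'` with
  `k ∤ a` is not a `k`-th power in `L`.
* §2 **`root_intCast_not_mem_ringClassField`** — for `K` imaginary quadratic, `ι : K → ℂ`, `m ≥ 1`,
  a prime `ℓ` with `ℓ ∤ m` and `ℓ ∤ d_K`, and `d = ℓᵃ·d'` with `ℓ ∤ d'`, `k ∤ a`: **no `r ∈ ℂ` with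
  `r^k = d` lies in `K[m]`.** PROOF = the tree's `sqrt_intCast_not_mem_ringClassField`
  (`RingClassFieldGenusProofs.lean`, the case `k = 2`, `a = 1`) with the parity step generalised: a prime
  `w` of `K[m]` above `ℓ` is unramified over `v = w ∩ 𝓞_K` because `v ∤ m` (Cox §9.A, p. 180:
  *"all primes of `K` ramified in `L` must divide `f𝒪_K`"* — the tree's PROVED
  `isUnramifiedIn_ringClassField`), and `v` is unramified over `ℓ` because `ℓ ∤ d_K` (Dedekind, Mathlib
  `NumberField.not_dvd_discr_iff_forall_mem`); so `e(w | ℓ) = 1`, `ord_w(d) = a`, and `k ∤ a` forbids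
  `d = r^k` in `K[m]`. Corollary `root_intCast_not_mem_ringClassField_of_dvd_of_not_sq_dvd` (`ℓ ∥ d`,
  any `k ≥ 2`).
* §3 `exists_eq_emb_of_forall_apply_eq` — scalar Galois descent along an embedding `emb : L → K̄` over `K`
  (`L/K` any algebraic extension, e.g. `K[m]`): an element of `K̄` fixed by every `g ∈ Γ_K` with
  `g ∘ emb = emb` lies in `emb(L)` (Mathlib `InfiniteGalois.fixedField_fixingSubgroup`; the point version is
  `exists_embPoints_eq_of_forall_smul_eq` of `GeomPointsEmbeddingDescent.lean`) — the bridge by which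
  `ᵏ√d ∉ K[m]` becomes «no `Gal(K̄/K[m])`-fixed `k`-th root of `d` in `K̄`».

HONEST FRAMING: classical class field theory (ramification in ring class fields) + valuations; nothing
about `L`-functions, Selmer groups, `Ш` or BSD is asserted; no summit statement is touched.

## References

* D. A. Cox, *Primes of the form x² + ny²*, 2nd ed. (2013), §9.A (p. 180: "all primes of `K` ramified in
  `L` must divide `f𝒪_K`"), §11.A Thm. 11.1 (held `book:cox2013-primes-form-i-x-sup-2-sup`, PDF p0193).
  [Cox2013]
* J. Neukirch, *Algebraic Number Theory* (1999), Ch. I §8 (ramification index), §11 (exponential valuations),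
  Ch. III Thm. (2.12) (Dedekind: ramified `⟺` divides the discriminant), Ch. IV Thm. (1.2) (infinite Galois
  correspondence; held `book:bynd-algebraic-number-theory`, PDF p0050, p0073, p0243). [NeukirchANT1999]
* J. H. Silverman, *The Arithmetic of Elliptic Curves*, 2nd ed. (2009), VIII.§1 (Galois descent
  `K̄^{G_{K̄/L}} = L`). [SilvermanAEC2009]

## Mathlib / tree search
Tree: `sqrt_intCast_not_mem_ringClassField`, `isUnramifiedIn_ringClassField`,
`finiteDimensional_and_isGalois_ringClassField`, `liesOver_span_of_natCast_mem_asIdeal`,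
`intCast_mem_asIdeal_iff_of_natCast_mem`; Mathlib: `IsDedekindDomain.HeightOneSpectrum.intValuation_liesOver`,
`Ideal.ramificationIdx'_eq_ramificationIdx`, `Ideal.ramificationIdx_eq_one_of_isUnramifiedAt`,
`WithZero.log_pow`, `InfiniteGalois.fixedField_fixingSubgroup`.
`lean search 'not_mem_ringClassField'` → only square-root statements (8 decls; none for `k ≥ 3`).
presearch: «k-th root not in ring class field / unramified outside conductor» →
[corpus:book:cox2013-primes-form-i-x-sup-2-sup p0193] (§9.A ramification statement; the tree proves it as
`isUnramifiedIn_ringClassField`).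
-/

noncomputable section

open NumberField IsDedekindDomain IsDedekindDomain.HeightOneSpectrum

namespace Literature.NumberTheory.EllipticCurves

open Literature.NumberTheory.GaloisRepresentations Literature.NumberTheory.NumberFields

/-! ### §1. Valuations: `k`-th powers, and integers at an absolutely unramified place -/

section Valuations

variable {L : Type*} [Field L] [NumberField L]

/-- `ord_w(r^k) = k · ord_w(r)`: the logarithm of the `w`-adic valuation of a `k`-th power is
divisible by `k` (the exponential valuation is a homomorphism `L^× → ℤ`).
[cite: NeukirchANT1999, Ch. I §11 (exponential valuations v_𝔭 : K^* → ℤ)] -/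
theorem dvd_log_valuation_pow (w : HeightOneSpectrum (𝓞 L)) (r : L) (k : ℕ) :
    (k : ℤ) ∣ WithZero.log (w.valuation L (r ^ k)) := by
  rw [map_pow, WithZero.log_pow, nsmul_eq_mul]
  exact dvd_mul_right _ _

/-- An element whose `w`-adic order is NOT divisible by `k` is not a `k`-th power in `L`.
[cite: NeukirchANT1999, Ch. I §11 (exponential valuations v_𝔭 : K^* → ℤ)] -/
theorem pow_ne_of_not_dvd_log_valuation (w : HeightOneSpectrum (𝓞 L)) {x : L} {k : ℕ}
    (hk : ¬ (k : ℤ) ∣ WithZero.log (w.valuation L x)) (r : L) : r ^ k ≠ x :=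
  fun h ↦ hk (h ▸ dvd_log_valuation_pow w r k)

/-- **`ord_w(ℓᵃ·d') = a` at a place `w ∋ ℓ` with `e(w | ℓ) = 1`** (`ℓ` prime, `ℓ ∤ d'`): by Mathlib's
`intValuation_liesOver`, `ord_w = e(w|ℓ) · ord_ℓ` on integers. (Here `e(w|ℓ)` is Mathlib's
`Ideal.ramificationIdx w ℤ`, equal to `ramificationIdx' (ℓ) w`.)
[cite: NeukirchANT1999, Ch. I §8, (8.1)–(8.2) (ramification index: 𝔭𝒪 = ∏ 𝔓ᵢ^{eᵢ}, so v_𝔓 = e·v_𝔭 on K)] -/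
theorem valuation_intCast_of_ramificationIdx_eq_one (w : HeightOneSpectrum (𝓞 L)) {ℓ : ℕ}
    (hℓ : ℓ.Prime) (hℓw : ((ℓ : ℕ) : 𝓞 L) ∈ w.asIdeal) (he : w.asIdeal.ramificationIdx ℤ = 1)
    (a : ℕ) {d' : ℤ} (hd' : ¬ (ℓ : ℤ) ∣ d') :
    w.valuation L ((((ℓ : ℤ) ^ a * d' : ℤ)) : L) = WithZero.exp (-(a : ℤ)) := by
  have hℓ0 : (ℓ : ℤ) ≠ 0 := by exact_mod_cast hℓ.ne_zero
  -- the place `(ℓ)` of `ℤ` below `w`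
  have hprime : (Ideal.span {(ℓ : ℤ)}).IsPrime :=
    (Ideal.span_singleton_prime hℓ0).mpr (Nat.prime_iff_prime_int.mp hℓ)
  have hbot : Ideal.span {(ℓ : ℤ)} ≠ ⊥ := by
    rw [ne_eq, Ideal.span_singleton_eq_bot]
    exact hℓ0
  set u : HeightOneSpectrum ℤ := ⟨Ideal.span {(ℓ : ℤ)}, hprime, hbot⟩ with hu
  haveI hlo : w.asIdeal.LiesOver u.asIdeal := liesOver_span_of_natCast_mem_asIdeal hℓ w hℓw
  -- `e(w | ℓ) = 1`
  have he' : u.asIdeal.ramificationIdx' w.asIdeal = 1 := by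
    rw [Ideal.ramificationIdx'_eq_ramificationIdx u.asIdeal w.asIdeal hbot]
    exact he
  -- `ord_ℓ (ℓᵃ d') = a`
  have hud : u.intValuation ((ℓ : ℤ) ^ a * d') = WithZero.exp (-(a : ℤ)) := by
    rw [map_mul, map_pow, HeightOneSpectrum.intValuation_singleton (v := u) hℓ0 rfl,
      HeightOneSpectrum.intValuation_eq_one_iff.2 (by rwa [hu, Ideal.mem_span_singleton]), mul_one,
      ← WithZero.exp_nsmul, nsmul_eq_mul, mul_neg, mul_one]
  -- transfer to `w`
  have hwd : w.intValuation ((((ℓ : ℤ) ^ a * d' : ℤ)) : 𝓞 L) = WithZero.exp (-(a : ℤ)) := by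
    have h := HeightOneSpectrum.intValuation_liesOver u w ((ℓ : ℤ) ^ a * d')
    rw [he', pow_one, hud] at h
    rw [← map_intCast (algebraMap ℤ (𝓞 L))]
    exact h.symm
  rw [← map_intCast (algebraMap (𝓞 L) L), HeightOneSpectrum.valuation_of_algebraMap, hwd]

/-- **`ℓᵃ·d'` with `k ∤ a`, `ℓ ∤ d'` is not a `k`-th power in `L`** once `L` has a place `w ∋ ℓ` with
`e(w | ℓ) = 1` (`ord_w(ℓᵃ d') = a` is not a multiple of `k`).
[cite: NeukirchANT1999, Ch. I §8, (8.1)–(8.2) (ramification index) and §11 (exponential valuations)] -/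
theorem pow_ne_intCast_of_ramificationIdx_eq_one (w : HeightOneSpectrum (𝓞 L)) {ℓ : ℕ}
    (hℓ : ℓ.Prime) (hℓw : ((ℓ : ℕ) : 𝓞 L) ∈ w.asIdeal) (he : w.asIdeal.ramificationIdx ℤ = 1)
    {a k : ℕ} (hka : ¬ k ∣ a) {d' : ℤ} (hd' : ¬ (ℓ : ℤ) ∣ d') (r : L) :
    r ^ k ≠ ((((ℓ : ℤ) ^ a * d' : ℤ)) : L) := by
  refine pow_ne_of_not_dvd_log_valuation w (fun h ↦ hka ?_) r
  rw [valuation_intCast_of_ramificationIdx_eq_one w hℓ hℓw he a hd', WithZero.log_exp, dvd_neg] at h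
  exact Int.natCast_dvd_natCast.mp h

end Valuations

/-! ### §2. `ᵏ√d ∉ K[m]` for `ℓᵃ ∥ d`, `k ∤ a`, `ℓ ∤ m·d_K` -/

variable {K : Type} [Field K] [NumberField K]

/-- **Radicals outside the ring class field.** Let `K` be imaginary quadratic, `ι : K → ℂ`, `m ≥ 1`,
`ℓ` a prime with `ℓ ∤ m` and `ℓ ∤ d_K`, and `d = ℓᵃ·d'` an integer with `ℓ ∤ d'` and `k ∤ a`. Then no
complex `k`-th root `r` of `d` lies in `K[m] = ringClassField K ι m`. For a prime `w` of `K[m]` above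
`ℓ` is unramified over `v = w ∩ 𝓞_K` (Cox §9.A: "all primes of `K` ramified in [the ring class field
of conductor `m`] must divide `m𝒪_K`" — the tree's `isUnramifiedIn_ringClassField`) and `v` is
unramified over `ℓ` (`ℓ ∤ d_K`, Dedekind's discriminant theorem), so `e(w | ℓ) = 1` and
`ord_w(d) = a` is not a multiple of `k = ord_w(r^k)/ord_w(r)`. The case `k = 2`, `a = 1` is the tree's
`sqrt_intCast_not_mem_ringClassField`. [cite: Cox2013, §9.A (p. 180) with §11.A Thm. 11.1]
[cite: NeukirchANT1999, Ch. III Thm. (2.12)] -/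
theorem root_intCast_not_mem_ringClassField (hK : IsImaginaryQuadratic K) (ι : K →+* ℂ) {m ℓ : ℕ}
    (hm : m ≠ 0) (hℓ : ℓ.Prime) (hℓm : ¬ ℓ ∣ m) (hℓD : ¬ (ℓ : ℤ) ∣ NumberField.discr K)
    {a k : ℕ} (hka : ¬ k ∣ a) {d' : ℤ} (hd' : ¬ (ℓ : ℤ) ∣ d')
    (r : ℂ) (hr : r ^ k = (ℓ : ℂ) ^ a * (d' : ℂ)) :
    r ∉ ringClassField K ι m := by
  intro hrL
  set L := ringClassField K ι m with hLdef
  haveI := (finiteDimensional_and_isGalois_ringClassField hK ι hm).1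
  haveI : NumberField L := NumberField.of_module_finite K L
  -- a prime `w` of `L` above `ℓ`, and `v = w ∩ 𝓞 K`
  have hℓZ : Prime (ℓ : ℤ) := Nat.prime_iff_prime_int.mp hℓ
  haveI hmax : (Ideal.span {(ℓ : ℤ)}).IsMaximal :=
    ((Ideal.span_singleton_prime hℓZ.ne_zero).mpr hℓZ).isMaximal
      (by rw [Ne, Ideal.span_singleton_eq_bot]; exact hℓZ.ne_zero)
  obtain ⟨W, hWmax, hWover⟩ :=
    Ideal.exists_maximal_ideal_liesOver_of_isIntegral (R := ℤ) (S := 𝓞 L) (Ideal.span {(ℓ : ℤ)})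
  have hWbot : W ≠ ⊥ := Ring.ne_bot_of_isMaximal_of_not_isField hWmax (RingOfIntegers.not_isField L)
  set w : HeightOneSpectrum (𝓞 L) := ⟨W, hWmax.isPrime, hWbot⟩ with hwdef
  have hℓw : ((ℓ : ℕ) : 𝓞 L) ∈ w.asIdeal := by
    have : algebraMap ℤ (𝓞 L) (ℓ : ℤ) ∈ W := by
      rw [← Ideal.mem_comap, ← Ideal.under_def, ← hWover.over]
      exact Ideal.mem_span_singleton_self _
    simpa using this
  set v : HeightOneSpectrum (𝓞 K) := w.under (𝓞 K) with hvdef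
  haveI hwv : w.asIdeal.LiesOver v.asIdeal := ⟨rfl⟩
  have hℓv : ((ℓ : ℕ) : 𝓞 K) ∈ v.asIdeal := by
    change algebraMap (𝓞 K) (𝓞 L) ((ℓ : ℕ) : 𝓞 K) ∈ w.asIdeal
    rw [map_natCast]; exact hℓw
  -- `e(v | ℓ) = 1` since `ℓ ∤ d_K`
  haveI hunrv : Algebra.IsUnramifiedAt ℤ v.asIdeal :=
    (NumberField.not_dvd_discr_iff_forall_mem K (𝓞 K) hℓZ).mp hℓD v.asIdeal inferInstance
      (by exact_mod_cast hℓv)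
  -- `e(w | v) = 1` since `v ∤ m`
  have hvm : ¬ Ideal.span {((m : ℕ) : 𝓞 K)} ≤ v.asIdeal := by
    intro hle
    have hmv : ((m : ℤ) : 𝓞 K) ∈ v.asIdeal := by
      have := (Ideal.span_singleton_le_iff_mem _).mp hle
      simpa using this
    exact hℓm (by exact_mod_cast (intCast_mem_asIdeal_iff_of_natCast_mem hℓ v hℓv (m : ℤ)).mp hmv)
  haveI hunrw : Algebra.IsUnramifiedAt (𝓞 K) w.asIdeal :=
    isUnramifiedIn_ringClassField hK ι hm hvm w.asIdeal w.isPrime hwv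
  -- hence `e(w | ℓ) = 1`
  haveI : Algebra.IsUnramifiedAt ℤ w.asIdeal :=
    Algebra.IsUnramifiedAt.comp (R := ℤ) (A := 𝓞 K) v.asIdeal w.asIdeal
  have he : w.asIdeal.ramificationIdx ℤ = 1 := Ideal.ramificationIdx_eq_one_of_isUnramifiedAt
  -- `d = r^k` in `L`: contradiction with `ord_w(d) = a`, `k ∤ a`
  refine pow_ne_intCast_of_ramificationIdx_eq_one w hℓ hℓw he hka hd' ⟨r, hrL⟩ ?_
  apply Subtype.ext
  have h1 : (((⟨r, hrL⟩ : L) ^ k : L) : ℂ) = r ^ k := by simp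
  have h2 : ((((((ℓ : ℤ) ^ a * d' : ℤ)) : L) : L) : ℂ) = (ℓ : ℂ) ^ a * (d' : ℂ) := by
    push_cast
    rfl
  rw [h1, h2, hr]

/-- `√d`-free corollary shape: for `ℓ ∥ d` (`ℓ ∣ d`, `ℓ² ∤ d`), no `k`-th root of `d` with `k ≥ 2`
lies in `K[m]` (`ℓ ∤ m`, `ℓ ∤ d_K`). [cite: Cox2013, §9.A (p. 180)] -/
theorem root_intCast_not_mem_ringClassField_of_dvd_of_not_sq_dvd (hK : IsImaginaryQuadratic K)
    (ι : K →+* ℂ) {m ℓ : ℕ} (hm : m ≠ 0) (hℓ : ℓ.Prime) (hℓm : ¬ ℓ ∣ m)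
    (hℓD : ¬ (ℓ : ℤ) ∣ NumberField.discr K) {d : ℤ} (hℓd : (ℓ : ℤ) ∣ d) (hℓ2d : ¬ (ℓ : ℤ) ^ 2 ∣ d)
    {k : ℕ} (hk : 2 ≤ k) (r : ℂ) (hr : r ^ k = (d : ℂ)) :
    r ∉ ringClassField K ι m := by
  obtain ⟨d', rfl⟩ := hℓd
  have hd' : ¬ (ℓ : ℤ) ∣ d' := fun h ↦ hℓ2d (by rw [sq]; exact mul_dvd_mul_left _ h)
  have hka : ¬ k ∣ 1 := fun h ↦ by
    have := Nat.le_of_dvd one_pos h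
    omega
  refine root_intCast_not_mem_ringClassField hK ι hm hℓ hℓm hℓD hka hd' r ?_
  rw [hr]; push_cast; ring

/-! ### §3. Scalar Galois descent along an embedding `emb : L → K̄` over `K` -/

section AlgClosure

variable {L : Type} [Field L] [Algebra K L] (emb : L →+* AlgebraicClosure K)

omit [NumberField K] in
/-- **Scalar Galois descent along an embedding `emb : L → K̄` over `K`** (`L/K` algebraic, e.g. a ring
class field): an element of `K̄` fixed by every `g ∈ Γ_K = Gal(K̄/K)` with `g ∘ emb = emb` lies in
`emb(L)` — infinite Galois theory, Mathlib `InfiniteGalois.fixedField_fixingSubgroup` for the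
intermediate field `emb(L)`. (The point version is `exists_embPoints_eq_of_forall_smul_eq`,
`GeomPointsEmbeddingDescent.lean`.) [cite: NeukirchANT1999, Ch. IV Thm. (1.2) (Galois correspondence for closed subgroups: K is the fixed field of G(Ω|K))]
[cite: SilvermanAEC2009, VIII.§1] -/
theorem exists_eq_emb_of_forall_apply_eq [CharZero K]
    (hemb : ∀ k : K, emb (algebraMap K L k) = algebraMap K (AlgebraicClosure K) k)
    (z : AlgebraicClosure K)
    (hz : ∀ g : Field.absoluteGaloisGroup K,
      (∀ x : L, (show AlgebraicClosure K ≃ₐ[K] AlgebraicClosure K from g) (emb x) = emb x) →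
        (show AlgebraicClosure K ≃ₐ[K] AlgebraicClosure K from g) z = z) :
    ∃ x : L, emb x = z := by
  haveI : IsGalois K (AlgebraicClosure K) := {}
  set E : IntermediateField K (AlgebraicClosure K) :=
    (AlgHom.mk emb hemb : L →ₐ[K] AlgebraicClosure K).fieldRange with hE
  have hzE : z ∈ E := by
    rw [← InfiniteGalois.fixedField_fixingSubgroup E, IntermediateField.mem_fixedField_iff]
    intro g hg
    refine hz g fun x ↦ ?_
    exact hg ⟨emb x, (AlgHom.mem_fieldRange).mpr ⟨x, rfl⟩⟩
  obtain ⟨x, hx⟩ := (AlgHom.mem_fieldRange).mp hzE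
  exact ⟨x, hx⟩

end AlgClosure

end Literature.NumberTheory.EllipticCurves
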